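import Summits.AnomalousDissipation.AnomalousDissipation.Theses.DopplerClock
import Summits.AnomalousDissipation.AnomalousDissipation.Theorems.DopplerClockQuadratureStressFloorEnergyFreeBridge
import Summits.AnomalousDissipation.AnomalousDissipation.Theorems.DopplerClockLongitudinalClassQuiet
import Literature.Analysis.FluidPDE.TorusClassicalLerayHopfProofs
import Summits.AnomalousDissipation.AnomalousDissipation.Theorems.DopplerClockQuadratureStressFloorLaminarCalibration
import Summits.AnomalousDissipation.AnomalousDissipation.Theorems.DopplerClockDopplerWorkIdentity
import Summits.AnomalousDissipation.AnomalousDissipation.Theorems.DopplerClockLongitudinalClassQuietModes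
import Literature.Analysis.FluidPDE.DoeringFoiasPowerProofs
import Summits.AnomalousDissipation.AnomalousDissipation.Theorems.ImpulseGridGridSignsLawSteadyNecessary

/-!
# Disproof of `QuadratureStressFloor` — findings: NO KILL; the floor is a dissipation floor, every
# quiet class is excluded, the laminar family meets the clauses with `T_s ≡ 0`, the momentum pinning
# is load-bearing, the guards `0 < m, n` are necessary; the unconditional kill = sweeping decorrelation (open)

Crux C1 = `Summit.AnomalousDissipation.AnomalousDissipation.Theses.DopplerClock.QuadratureStressFloor`
(stmt-AnomalousDissipation-18129), cdisprove seat `refuter-cdisprove-stmt-AnomalousDissipation-18129-0`,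
cycle 1 (2026-08-17).  Everything conclusive below is LANDED (kernel-checked, `--supports` the crux):

* `Theorems/QuadratureStressFloor/Negative/DissipationFloor.lean` (p172446):
  `Negative.neg_longTimeAvg_stress_le`, `Negative.exists_neg_longTimeAvg_stress_lt_of_dormant`,
  `Negative.not_quadratureStressFloor_longitudinalClass`;
* `Theorems/QuadratureStressFloor/Negative/LaminarWitnesses.lean` (p172503):
  `Negative.laminar_clauses_stress_zero`, `Negative.quadratureStressFloor_holds_without_floor`,
  `Negative.not_quadratureStressFloor_forall_families`,
  `Negative.quadratureStressFloor_holds_without_momentumPinning`,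
  `Negative.not_stressFloor_of_m_eq_zero`, `Negative.not_stressFloor_of_n_eq_zero`
  (+ helpers `fderiv_pattern_single_zero`, `convect_streak_pattern`, `stress_streak_eq_zero`,
  `stress_eq_zero_of_{m,n}_eq_zero`).

## Verdict of the junk / vacuity audit (NOTES.md §Elaboration)
No junk route: `GeneralizedLimit` is honest on the Cesàro means of `T_s(w_j)` (eventually bounded
under the per-`j` energy clause; `liminf ≤ Λ ≤ limsup`), `convect`/Bochner junk only produce `0`
integrands (which the floor clause then refuses), and the `toReal` deflation inside
`meanDissipation` can only make no-leak HARDER.  C1 is an honest open `∃`-statement, equivalent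
(`dopplerClock_quadratureStressFloor_iff_energyFreeInjectionFloor`, p168484) to an energy-free,
no-leak, pinned-momentum INJECTION floor for the Doppler force in one generalized limit — anomalous
dissipation for one explicit smooth force.  Its negation is a sweeping-decorrelation theorem for ALL
such families (open; §(e)).  Kit evidence of earlier seats (j023171/j023208/j023236: ν-uniform real
instability of the drifted streaks; j023174: DNS floor alive to ν = 2.5e-3; j025532/j025533) is in
favour of C1 and was not rerun.

## Contents
* (a) load-bearing analysis — `QuadratureStressFloorWithoutMomentumPinning` HOLDS (pinning is
  load-bearing: without it undrifted laminar states give a floor), `QuadratureStressFloorWithoutFloor`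
  HOLDS (clauses (i)–(v) are jointly satisfiable by laminar states: only the floor carries content);
  the Leray–Hopf / no-leak / `ν → 0` deletions are not cheaply decidable (they still ask for loud
  witnesses) and are recorded as remarks.
* (b) tightness — the floor costs dissipation: `stressFloor_forces_dissipationFloor`; dormant
  families are excluded: `no_floor_of_dormant`.
* (c) strengthenings refuted — `not_QuadratureStressFloorForallFamilies` (∀ families),
  `not_QuadratureStressFloorLongitudinal` (x₀-invariant classical witnesses),
  `not_floor_at_m_zero` / `not_floor_at_n_zero` (guards).
* (d) `-- Targets`: none served (payload.targets = []); `-- Line Sketch`: its only open stub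
  `stub_loudPeriodicWitnessesEnergyFree` is the crux itself through the landed iff — nothing weaker
  than `¬ C1` kills it; line declared dead-as-≡-crux by lead c2 (`Lines/Sketch-dead.md`).
  `-- Line steady-pitchfork-branch` (registered, not picked): its core `stub_quietRigidity` is
  killable by ONE quiet non-laminar R₂-symmetric steady drift state — a Newton/continuation
  computation (j023495 inconclusive); by (b) such a state carries no stress floor either.
* (e) near-miss — `SweepDecorrelation` (= `¬ C1` in census format `StrategyCensus.not_crux_iff`),
  `not_quadratureStressFloor_of_sweepDecorrelation` (proved), `sweepDecorrelation` (SORRY: open).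

## INTERIM SELF-CONTAINED EDITION
The canonical `Disproof.lean` (in the seat folder) IMPORTS the two landed modules
`Theorems/QuadratureStressFloor/Negative/{DissipationFloor,LaminarWitnesses}.lean` (p172446, p172503, both
ACCEPTED 2026-08-17T18:2xZ).  At publication time the farm had not yet built their oleans
(`remote:incoherent:no-olean`), and a crux workfile must elaborate, so THIS edition inlines verbatim
copies of those modules under the namespace `…Cruxes.QuadratureStressFloor.Disproof.Landed` (to avoid
any FQN clash with the tree modules) and §§(a)–(e) refer to `Landed.*`; read `Landed.X` as
`Summit.AnomalousDissipation.AnomalousDissipation.Theorems.QuadratureStressFloor.Negative.X`.  The next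
seat on this crux should swap the inlined part for the two imports (file `Disproof.lean` of the folder).
-/

noncomputable section

-- `Summit.<Summit>.<Problem>` is the tree's mandated summit-side namespace (CONVENTIONS §2); for this
-- single-conjunct summit the two coincide, so the duplicate is deliberate.
set_option linter.dupNamespace false

open MeasureTheory Set Filter Topology
open scoped InnerProductSpace RealInnerProductSpace

namespace Summit.AnomalousDissipation.AnomalousDissipation.Cruxes.QuadratureStressFloor.Disproof.Landed

open Literature.Analysis.FunctionSpaces Literature.Analysis.FunctionSpaces.Torus
open Literature.Analysis.FluidPDE Literature.Analysis.FluidPDE.Torus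
open Summit.AnomalousDissipation.AnomalousDissipation.Theorems


/-! ### (a) The stress floor is a dissipation floor, witness by witness -/

open EnergyFreeBridge in
/-- **The quadrature-stress floor is paid in dissipation (per witness, energy-free).** For a global
Leray–Hopf drift-`V` solution `u` of the Doppler force at viscosity `ν > 0` with a forward energy bound
and no leakage, `−Λ⟨T_s(u − V e₂)⟩ ≤ (2πnV/F + κ²/(8π²)) · meanDissipation ν u + νκ²/2`,
`κ² = (2π)²(m² + n²)`: the work identity (item 18133) solved for `−Λ⟨T_s⟩`, the energy-free clock-term
bound `|Λ⟨(Ψ_s,u)⟩| ≤ ½ + Λ⟨(f,u)⟩/(8π²ν)` (`EnergyFreeBridge.abs_longTimeAvg_inner_le`, `δ = 1`),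
`Λ ≤ limsup` on the bounded injection means and the no-leak clause. [folklore] -/
theorem neg_longTimeAvg_stress_le (Λ : GeneralizedLimit) {F V ν : ℝ} {m n : ℕ} {u₀ : UnitAddTorus (Fin 3) → EuclideanSpace ℝ (Fin 3)}
    {u : ℝ → UnitAddTorus (Fin 3) → EuclideanSpace ℝ (Fin 3)} (hF : 0 < F) (hV : 0 < V) (hν : 0 < ν) (hm : 0 < m) (hn : 0 < n)
    (hLH : IsGlobalLerayHopf ν (fun _ => fun x : UnitAddTorus (Fin 3) => (F * (UnitAddTorus.mFourier (Pi.single (1 : Fin 3) ((m : ℕ) : ℤ)) x).im * (UnitAddTorus.mFourier (Pi.single (2 : Fin 3) ((n : ℕ) : ℤ)) x).re) • EuclideanSpace.single (0 : Fin 3) (1 : ℝ)) u₀ u)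
    (hmom : ∫ x, u₀ x = V • EuclideanSpace.single (2 : Fin 3) (1 : ℝ))
    (hsup : ∃ C : ℝ, ∀ t : ℝ, 0 ≤ t → kineticEnergy (u t) ≤ C)
    (hnoleak : longTimeAvgSup (fun t => ∫ x, ⟪(F * (UnitAddTorus.mFourier (Pi.single (1 : Fin 3) ((m : ℕ) : ℤ)) x).im * (UnitAddTorus.mFourier (Pi.single (2 : Fin 3) ((n : ℕ) : ℤ)) x).re) • EuclideanSpace.single (0 : Fin 3) (1 : ℝ), u t x⟫) ≤
      meanDissipation ν u) :
    -Λ.longTimeAvg (fun t => ∫ x, ⟪u t x - V • EuclideanSpace.single (2 : Fin 3) (1 : ℝ),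
        convect (fun y => u t y - V • EuclideanSpace.single (2 : Fin 3) (1 : ℝ)) (fun y : UnitAddTorus (Fin 3) => ((UnitAddTorus.mFourier (Pi.single (1 : Fin 3) ((m : ℕ) : ℤ)) y).im * (UnitAddTorus.mFourier (Pi.single (2 : Fin 3) ((n : ℕ) : ℤ)) y).im) • EuclideanSpace.single (0 : Fin 3) (1 : ℝ)) x⟫) ≤
      (V * (2 * Real.pi * n) / F + (2 * Real.pi) ^ 2 * ((m : ℝ) ^ 2 + (n : ℝ) ^ 2) / (8 * Real.pi ^ 2)) *
          meanDissipation ν u +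
        ν * ((2 * Real.pi) ^ 2 * ((m : ℝ) ^ 2 + (n : ℝ) ^ 2)) / 2 := by
  -- abbreviations for the force and the quadrature pattern
  set f : UnitAddTorus (Fin 3) → EuclideanSpace ℝ (Fin 3) := fun x => (F * (UnitAddTorus.mFourier (Pi.single (1 : Fin 3) ((m : ℕ) : ℤ)) x).im * (UnitAddTorus.mFourier (Pi.single (2 : Fin 3) ((n : ℕ) : ℤ)) x).re) • EuclideanSpace.single (0 : Fin 3) (1 : ℝ) with hfdef
  set Ψ : UnitAddTorus (Fin 3) → EuclideanSpace ℝ (Fin 3) := fun y => ((UnitAddTorus.mFourier (Pi.single (1 : Fin 3) ((m : ℕ) : ℤ)) y).im * (UnitAddTorus.mFourier (Pi.single (2 : Fin 3) ((n : ℕ) : ℤ)) y).im) • EuclideanSpace.single (0 : Fin 3) (1 : ℝ) with hΨdef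
  have hfS : IsSmooth f := dopplerClock_isSmooth_im_mul_re_smul F _ _ _
  have hf0 : HasZeroMean f := dopplerForce_hasZeroMean F _ _
  have hΨc : Continuous Ψ := (dopplerClock_isSmooth_im_mul_im_smul _ _ _).continuous
  have hΨ0 : HasZeroMean Ψ := pattern_hasZeroMean hm n
  have hΨ1 : ∀ x, ‖Ψ x‖ ≤ 1 := norm_pattern_le_one m n
  -- constants
  have hn' : (0 : ℝ) < (n : ℝ) := Nat.cast_pos.2 hn
  set κ2 : ℝ := (2 * Real.pi) ^ 2 * ((m : ℝ) ^ 2 + (n : ℝ) ^ 2) with hκ2def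
  have hκ2 : 0 ≤ κ2 := by rw [hκ2def]; positivity
  set c : ℝ := V * (2 * Real.pi * n) / F with hcdef
  have hc : 0 < c := by rw [hcdef]; positivity
  -- the identity, solved for `−Λ⟨T_s⟩`
  have hid : -Λ.longTimeAvg (fun t => ∫ x, ⟪u t x - V • EuclideanSpace.single (2 : Fin 3) (1 : ℝ), convect (fun y => u t y - V • EuclideanSpace.single (2 : Fin 3) (1 : ℝ)) Ψ x⟫) =
      c * Λ.longTimeAvg (fun t => ∫ x, ⟪f x, u t x⟫) -
        ν * κ2 * Λ.longTimeAvg (fun t => ∫ x, ⟪Ψ x, u t x⟫) := by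
    have h := dopplerWorkIdentity_proof Λ F V ν m n u₀ u hV hν hn hLH hmom hsup
    have hFne : F ≠ 0 := hF.ne'
    have hVne : V * (2 * Real.pi * n) ≠ 0 := by positivity
    rw [hcdef, h]
    field_simp
    ring
  -- the clock-term bound at `δ = 1`
  have hB : |Λ.longTimeAvg (fun t => ∫ x, ⟪Ψ x, u t x⟫)| ≤
      1 / 2 + 1 ^ 2 / (8 * Real.pi ^ 2 * ν * 1) * Λ.longTimeAvg (fun t => ∫ x, ⟪f x, u t x⟫) :=
    abs_longTimeAvg_inner_le Λ hν hfS hf0 hLH hsup hΨc hΨ0 hΨ1 one_pos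
  -- `Λ⟨(f,u)⟩ ≤ ⟨(f,u)⟩⁺ ≤ meanDissipation` (no leak)
  have hP : Λ.longTimeAvg (fun t => ∫ x, ⟪f x, u t x⟫) ≤ meanDissipation ν u :=
    (LoudWakes.longTimeAvg_inner_le_longTimeAvgSup Λ hfS.continuous hLH hsup).trans hnoleak
  -- arithmetic
  set P := Λ.longTimeAvg (fun t => ∫ x, ⟪f x, u t x⟫) with hPdef
  set B := Λ.longTimeAvg (fun t => ∫ x, ⟪Ψ x, u t x⟫) with hBdef
  have hpi : 0 < Real.pi ^ 2 := by positivity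
  have h1 : ν * κ2 * (-B) ≤ ν * κ2 * (1 / 2 + 1 ^ 2 / (8 * Real.pi ^ 2 * ν * 1) * P) :=
    mul_le_mul_of_nonneg_left ((neg_le_abs B).trans hB) (mul_nonneg hν.le hκ2)
  have h2 : ν * κ2 * (1 / 2 + 1 ^ 2 / (8 * Real.pi ^ 2 * ν * 1) * P) =
      ν * κ2 / 2 + κ2 / (8 * Real.pi ^ 2) * P := by
    field_simp
  have h3 : (c + κ2 / (8 * Real.pi ^ 2)) * P ≤ (c + κ2 / (8 * Real.pi ^ 2)) * meanDissipation ν u :=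
    mul_le_mul_of_nonneg_left hP (by positivity)
  rw [hid]
  nlinarith [h1, h2, h3]

/-- **Dormant families carry no floor.** Along any family of no-leak drift-`V` Leray–Hopf solutions of
the Doppler force with `ν_j → 0` whose mean dissipation tends to zero, the quadrature stress has no
`ν`-uniform floor: for every `ε₀ > 0` some member has `−Λ⟨T_s(w_j)⟩ < ε₀`
(`neg_longTimeAvg_stress_le` and `(c + κ²/(8π²))·ε̄_j + ν_jκ²/2 → 0`). In particular every witness
family of C1 is anomalously dissipating in `limsup`-mean: `liminf_j meanDissipation (ν_j) (u_j) > 0`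
along a subsequence. [folklore] -/
theorem exists_neg_longTimeAvg_stress_lt_of_dormant (Λ : GeneralizedLimit) {F V : ℝ} {m n : ℕ}
    {ν : ℕ → ℝ} {u₀ : ℕ → UnitAddTorus (Fin 3) → EuclideanSpace ℝ (Fin 3)} {u : ℕ → ℝ → UnitAddTorus (Fin 3) → EuclideanSpace ℝ (Fin 3)}
    (hF : 0 < F) (hV : 0 < V) (hm : 0 < m) (hn : 0 < n) (hν : ∀ j, 0 < ν j)
    (hν0 : Tendsto ν atTop (𝓝 0))
    (hLH : ∀ j, IsGlobalLerayHopf (ν j) (fun _ => fun x : UnitAddTorus (Fin 3) => (F * (UnitAddTorus.mFourier (Pi.single (1 : Fin 3) ((m : ℕ) : ℤ)) x).im * (UnitAddTorus.mFourier (Pi.single (2 : Fin 3) ((n : ℕ) : ℤ)) x).re) • EuclideanSpace.single (0 : Fin 3) (1 : ℝ))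
      (u₀ j) (u j))
    (hmom : ∀ j, ∫ x, u₀ j x = V • EuclideanSpace.single (2 : Fin 3) (1 : ℝ))
    (hsup : ∀ j, ∃ C : ℝ, ∀ t : ℝ, 0 ≤ t → kineticEnergy (u j t) ≤ C)
    (hnoleak : ∀ j, longTimeAvgSup (fun t => ∫ x, ⟪(F * (UnitAddTorus.mFourier (Pi.single (1 : Fin 3) ((m : ℕ) : ℤ)) x).im * (UnitAddTorus.mFourier (Pi.single (2 : Fin 3) ((n : ℕ) : ℤ)) x).re) • EuclideanSpace.single (0 : Fin 3) (1 : ℝ), u j t x⟫) ≤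
      meanDissipation (ν j) (u j))
    (hdormant : Tendsto (fun j => meanDissipation (ν j) (u j)) atTop (𝓝 0)) {ε₀ : ℝ} (hε₀ : 0 < ε₀) :
    ∃ j, -Λ.longTimeAvg (fun t => ∫ x, ⟪u j t x - V • EuclideanSpace.single (2 : Fin 3) (1 : ℝ),
        convect (fun y => u j t y - V • EuclideanSpace.single (2 : Fin 3) (1 : ℝ)) (fun y : UnitAddTorus (Fin 3) => ((UnitAddTorus.mFourier (Pi.single (1 : Fin 3) ((m : ℕ) : ℤ)) y).im * (UnitAddTorus.mFourier (Pi.single (2 : Fin 3) ((n : ℕ) : ℤ)) y).im) • EuclideanSpace.single (0 : Fin 3) (1 : ℝ)) x⟫) < ε₀ := by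
  set κ2 : ℝ := (2 * Real.pi) ^ 2 * ((m : ℝ) ^ 2 + (n : ℝ) ^ 2) with hκ2def
  set c : ℝ := V * (2 * Real.pi * n) / F with hcdef
  -- the per-witness bound tends to `0`
  have hlim : Tendsto (fun j => (c + κ2 / (8 * Real.pi ^ 2)) * meanDissipation (ν j) (u j) + ν j * κ2 / 2)
      atTop (𝓝 0) := by
    have h1 : Tendsto (fun j => (c + κ2 / (8 * Real.pi ^ 2)) * meanDissipation (ν j) (u j)) atTop (𝓝 0) := by
      simpa using hdormant.const_mul (c + κ2 / (8 * Real.pi ^ 2))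
    have h2 : Tendsto (fun j => ν j * κ2 / 2) atTop (𝓝 0) := by
      simpa using (hν0.mul_const κ2).div_const 2
    simpa using h1.add h2
  obtain ⟨j, hj⟩ := (eventually_atTop.1 (hlim.eventually (gt_mem_nhds hε₀)))
  refine ⟨j, ?_⟩
  have hle := neg_longTimeAvg_stress_le Λ hF hV (hν j) hm hn (hLH j) (hmom j) (hsup j) (hnoleak j)
  have hjj := hj j le_rfl
  exact hle.trans_lt (by simpa [hκ2def, hcdef, mul_div_assoc] using hjj)


/-! ### (b) The `x₀`-invariant (longitudinal) witness class is excluded -/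

/-- **No floor on the longitudinal class.** The crux restricted to `x₀`-INVARIANT classical witnesses
— classical solutions on `[0, ∞)` of the Doppler-forced system that do not depend on the streamwise
coordinate (streak arrays, their transients, every streamwise-independent state), with momentum
`V e₂`, forward energy bounds and no leakage — is FALSE: by `LongitudinalClassQuiet` (item 18134) such
solutions dissipate at most `ν κ²F²/(4V²(2πn)²)`, so by `neg_longTimeAvg_stress_le` their stress is
`O(ν_j)` and no `ε₀ > 0` survives `ν_j → 0`. A witness of C1 must break the streamwise symmetry
shared by the force and the pattern. [folklore] -/
theorem not_quadratureStressFloor_longitudinalClass :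
    ¬ ∃ (F V : ℝ) (m n : ℕ), 0 < F ∧ 0 < V ∧ 0 < m ∧ 0 < n ∧ ∃ (Λ : GeneralizedLimit),
      ∃ (ν : ℕ → ℝ) (u : ℕ → ℝ → UnitAddTorus (Fin 3) → EuclideanSpace ℝ (Fin 3)) (p : ℕ → ℝ → UnitAddTorus (Fin 3) → ℝ),
        (∀ j, 0 < ν j) ∧ Tendsto ν atTop (𝓝 0) ∧
        (∀ j, IsClassicalNSSolutionOn (Set.Ici 0) (ν j)
          (fun _ => fun x : UnitAddTorus (Fin 3) => (F * (UnitAddTorus.mFourier (Pi.single (1 : Fin 3) ((m : ℕ) : ℤ)) x).im * (UnitAddTorus.mFourier (Pi.single (2 : Fin 3) ((n : ℕ) : ℤ)) x).re) • EuclideanSpace.single (0 : Fin 3) (1 : ℝ)) (u j) (p j)) ∧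
        (∀ j (t : ℝ) (c : UnitAddCircle) (x : UnitAddTorus (Fin 3)), u j t (x + Pi.single (0 : Fin 3) c) = u j t x) ∧
        (∀ j, ∫ x, u j 0 x = V • EuclideanSpace.single (2 : Fin 3) (1 : ℝ)) ∧
        (∀ j, ∃ C : ℝ, ∀ t : ℝ, 0 ≤ t → kineticEnergy (u j t) ≤ C) ∧
        (∀ j, longTimeAvgSup (fun t => ∫ x, ⟪(F * (UnitAddTorus.mFourier (Pi.single (1 : Fin 3) ((m : ℕ) : ℤ)) x).im * (UnitAddTorus.mFourier (Pi.single (2 : Fin 3) ((n : ℕ) : ℤ)) x).re) • EuclideanSpace.single (0 : Fin 3) (1 : ℝ), u j t x⟫) ≤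
          meanDissipation (ν j) (u j)) ∧
        ∃ ε₀ : ℝ, 0 < ε₀ ∧ ∀ j, ε₀ ≤ -Λ.longTimeAvg (fun t => ∫ x, ⟪u j t x - V • EuclideanSpace.single (2 : Fin 3) (1 : ℝ),
          convect (fun y => u j t y - V • EuclideanSpace.single (2 : Fin 3) (1 : ℝ)) (fun y : UnitAddTorus (Fin 3) => ((UnitAddTorus.mFourier (Pi.single (1 : Fin 3) ((m : ℕ) : ℤ)) y).im * (UnitAddTorus.mFourier (Pi.single (2 : Fin 3) ((n : ℕ) : ℤ)) y).im) • EuclideanSpace.single (0 : Fin 3) (1 : ℝ)) x⟫) := by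
  rintro ⟨F, V, m, n, hF, hV, hm, hn, Λ, ν, u, p, hν, hν0, hsol, hinv, hmom, hsup, hnoleak, ε₀, hε₀, hfloor⟩
  have hn' : (0 : ℝ) < (n : ℝ) := Nat.cast_pos.2 hn
  -- the class is quiet (item 18134) and classical solutions on `[0, ∞)` are global Leray–Hopf
  have hquiet : ∀ j, meanDissipation (ν j) (u j) ≤
      ν j * ((2 * Real.pi) ^ 2 * ((m : ℝ) ^ 2 + (n : ℝ) ^ 2)) * F ^ 2 / (4 * V ^ 2 * (2 * Real.pi * n) ^ 2) :=
    fun j => longitudinalClassQuiet_proof F V (ν j) m n (u j) (p j) hV (hν j) hn (hsol j) (hinv j) (hmom j)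
      (hsup j)
  have hLH : ∀ j, IsGlobalLerayHopf (ν j) (fun _ => fun x : UnitAddTorus (Fin 3) => (F * (UnitAddTorus.mFourier (Pi.single (1 : Fin 3) ((m : ℕ) : ℤ)) x).im * (UnitAddTorus.mFourier (Pi.single (2 : Fin 3) ((n : ℕ) : ℤ)) x).re) • EuclideanSpace.single (0 : Fin 3) (1 : ℝ))
      (u j 0) (u j) :=
    fun j T hT => (hsol j).isLerayHopfOn_of_convex (convex_Ici 0) hT Icc_subset_Ici_self
  -- hence `ε₀ ≤ ν_j · K` for a fixed constant `K`
  set K : ℝ := (V * (2 * Real.pi * n) / F + (2 * Real.pi) ^ 2 * ((m : ℝ) ^ 2 + (n : ℝ) ^ 2) / (8 * Real.pi ^ 2)) *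
      (((2 * Real.pi) ^ 2 * ((m : ℝ) ^ 2 + (n : ℝ) ^ 2)) * F ^ 2 / (4 * V ^ 2 * (2 * Real.pi * n) ^ 2)) +
    ((2 * Real.pi) ^ 2 * ((m : ℝ) ^ 2 + (n : ℝ) ^ 2)) / 2 with hKdef
  have hcoef : (0 : ℝ) ≤ V * (2 * Real.pi * n) / F +
      (2 * Real.pi) ^ 2 * ((m : ℝ) ^ 2 + (n : ℝ) ^ 2) / (8 * Real.pi ^ 2) := by positivity
  have key : ∀ j, ε₀ ≤ ν j * K := by
    intro j
    have h1 := hfloor j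
    have h2 := neg_longTimeAvg_stress_le Λ hF hV (hν j) hm hn (hLH j) (hmom j) (hsup j) (hnoleak j)
    have h3 := mul_le_mul_of_nonneg_left (hquiet j) hcoef
    have h4 : (V * (2 * Real.pi * n) / F + (2 * Real.pi) ^ 2 * ((m : ℝ) ^ 2 + (n : ℝ) ^ 2) / (8 * Real.pi ^ 2)) *
          (ν j * ((2 * Real.pi) ^ 2 * ((m : ℝ) ^ 2 + (n : ℝ) ^ 2)) * F ^ 2 / (4 * V ^ 2 * (2 * Real.pi * n) ^ 2)) +
        ν j * ((2 * Real.pi) ^ 2 * ((m : ℝ) ^ 2 + (n : ℝ) ^ 2)) / 2 = ν j * K := by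
      rw [hKdef]
      ring
    linarith
  -- but `ν_j · K → 0`
  have hlim : Tendsto (fun j => ν j * K) atTop (𝓝 0) := by simpa using hν0.mul_const K
  obtain ⟨j, hj⟩ := eventually_atTop.1 (hlim.eventually (gt_mem_nhds hε₀))
  exact lt_irrefl _ ((key j).trans_lt (hj j le_rfl))

end Summit.AnomalousDissipation.AnomalousDissipation.Cruxes.QuadratureStressFloor.Disproof.Landed

end

noncomputable section

-- `Summit.<Summit>.<Problem>` is the tree's mandated summit-side namespace (CONVENTIONS §2); for this
-- single-conjunct summit the two coincide, so the duplicate is deliberate.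
set_option linter.dupNamespace false

open MeasureTheory Set Filter Topology
open scoped InnerProductSpace RealInnerProductSpace

namespace Summit.AnomalousDissipation.AnomalousDissipation.Cruxes.QuadratureStressFloor.Disproof.Landed

open Literature.Analysis.FunctionSpaces Literature.Analysis.FunctionSpaces.Torus
open Literature.Analysis.FluidPDE Literature.Analysis.FluidPDE.Torus
open Summit.AnomalousDissipation.AnomalousDissipation.Theorems


/-! ### (c) The laminar family: clauses (i)–(v) hold with identically vanishing stress -/

/-- `DΨ_s(x)[e₀] = ∂₀Ψ_s(x) = 0`: the streak pattern does not depend on `x₀`. [folklore] -/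
theorem fderiv_pattern_single_zero (m n : ℕ) (x : UnitAddTorus (Fin 3)) :
    Torus.fderiv (fun y : UnitAddTorus (Fin 3) => ((UnitAddTorus.mFourier (Pi.single (1 : Fin 3) ((m : ℕ) : ℤ)) y).im * (UnitAddTorus.mFourier (Pi.single (2 : Fin 3) ((n : ℕ) : ℤ)) y).im) • EuclideanSpace.single (0 : Fin 3) (1 : ℝ)) x (EuclideanSpace.single (0 : Fin 3) (1 : ℝ)) = 0 := by
  rw [← partialDeriv_eq_fderiv_apply ((DopplerWork.pattern_regular m n).1.isContDiff (by simp)) 0 x]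
  exact DopplerStreaks.partialDeriv_zero_sinSin m n x

/-- **Transport of the streak pattern by a streak-plus-drift field**:
`((r e₀ + A e₂)·∇)Ψ_s = A ∂₂Ψ_s = A · 2πn Ψ_c` (`DΨ_s[e₀] = 0`, `∂₂Ψ_s = 2πn Ψ_c`). [folklore] -/
theorem convect_streak_pattern (m n : ℕ) (r : UnitAddTorus (Fin 3) → ℝ) (A : ℝ) (x : UnitAddTorus (Fin 3)) :
    convect (fun y : UnitAddTorus (Fin 3) => r y • EuclideanSpace.single (0 : Fin 3) (1 : ℝ) + A • EuclideanSpace.single (2 : Fin 3) (1 : ℝ)) (fun y : UnitAddTorus (Fin 3) => ((UnitAddTorus.mFourier (Pi.single (1 : Fin 3) ((m : ℕ) : ℤ)) y).im * (UnitAddTorus.mFourier (Pi.single (2 : Fin 3) ((n : ℕ) : ℤ)) y).im) • EuclideanSpace.single (0 : Fin 3) (1 : ℝ)) x =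
      A • ((2 * Real.pi * n * ((UnitAddTorus.mFourier (Pi.single (1 : Fin 3) ((m : ℕ) : ℤ)) x).im * (UnitAddTorus.mFourier (Pi.single (2 : Fin 3) ((n : ℕ) : ℤ)) x).re)) • EuclideanSpace.single (0 : Fin 3) (1 : ℝ)) := by
  have h1 : IsContDiff 1 (fun y : UnitAddTorus (Fin 3) => ((UnitAddTorus.mFourier (Pi.single (1 : Fin 3) ((m : ℕ) : ℤ)) y).im * (UnitAddTorus.mFourier (Pi.single (2 : Fin 3) ((n : ℕ) : ℤ)) y).im) • EuclideanSpace.single (0 : Fin 3) (1 : ℝ)) :=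
    (DopplerWork.pattern_regular m n).1.isContDiff (by simp)
  unfold Torus.convect
  rw [map_add, map_smul, map_smul, fderiv_pattern_single_zero, smul_zero, zero_add,
    ← partialDeriv_eq_fderiv_apply h1 2 x, DopplerWork.partialDeriv_two_pattern]

/-- **The stress of a pure streak field vanishes**: `T_s(r e₀) = ∫⟪r e₀, ((r e₀)·∇)Ψ_s⟫ = 0`
pointwise, since `((r e₀)·∇)Ψ_s = r ∂₀Ψ_s = 0`. [folklore] -/
theorem stress_streak_eq_zero (m n : ℕ) (r : UnitAddTorus (Fin 3) → ℝ) :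
    ∫ x, ⟪r x • EuclideanSpace.single (0 : Fin 3) (1 : ℝ), convect (fun y : UnitAddTorus (Fin 3) => r y • EuclideanSpace.single (0 : Fin 3) (1 : ℝ)) (fun y : UnitAddTorus (Fin 3) => ((UnitAddTorus.mFourier (Pi.single (1 : Fin 3) ((m : ℕ) : ℤ)) y).im * (UnitAddTorus.mFourier (Pi.single (2 : Fin 3) ((n : ℕ) : ℤ)) y).im) • EuclideanSpace.single (0 : Fin 3) (1 : ℝ)) x⟫ = 0 := by
  have h : ∀ x : UnitAddTorus (Fin 3), convect (fun y : UnitAddTorus (Fin 3) => r y • EuclideanSpace.single (0 : Fin 3) (1 : ℝ)) (fun y : UnitAddTorus (Fin 3) => ((UnitAddTorus.mFourier (Pi.single (1 : Fin 3) ((m : ℕ) : ℤ)) y).im * (UnitAddTorus.mFourier (Pi.single (2 : Fin 3) ((n : ℕ) : ℤ)) y).im) • EuclideanSpace.single (0 : Fin 3) (1 : ℝ)) x = 0 := by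
    intro x
    have := convect_streak_pattern m n r 0 x
    simp only [zero_smul, add_zero] at this
    exact this
  simp [h]

/-- **The drifted laminar family meets clauses (i)–(v) of C1 with identically vanishing stress.**
For EVERY design (`V > 0`, `n ≥ 1`, any `F`, `m`) and EVERY sequence of positive viscosities, the
steady streak arrays `u_L(ν_j) = V e₂ + sin(2πm x₁)[a_j cos + b_j sin](2πn x₂) e₀` of item 18132
(`dopplerClock_laminarStreaks_proof`) are global Leray–Hopf solutions (classical ⇒ Leray–Hopf,
Robinson–Rodrigo–Sadowski 2016 Thm. 6.5) with momentum `V e₂`, bounded energy and NO leakage (steady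
energy identity `ν‖∇u_L‖² = (f, u_L)`, spectral = pointwise gradient norm on the smooth slice), and
their quadrature stress `T_s(u_L − V e₂)` vanishes at every time (`u_L − V e₂ ∥ e₀`, `∂₀Ψ_s = 0`).
So the hypotheses (i)–(v) of the crux are jointly satisfiable and carry no information by
themselves: the floor clause is the whole content. [folklore] -/
theorem laminar_clauses_stress_zero (F V : ℝ) (m n : ℕ) (hV : 0 < V) (hn : 0 < n) (ν : ℕ → ℝ)
    (hν : ∀ j, 0 < ν j) :
    ∃ (u₀ : ℕ → UnitAddTorus (Fin 3) → EuclideanSpace ℝ (Fin 3)) (u : ℕ → ℝ → UnitAddTorus (Fin 3) → EuclideanSpace ℝ (Fin 3)),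
      (∀ j, IsGlobalLerayHopf (ν j) (fun _ => fun x : UnitAddTorus (Fin 3) => (F * (UnitAddTorus.mFourier (Pi.single (1 : Fin 3) ((m : ℕ) : ℤ)) x).im * (UnitAddTorus.mFourier (Pi.single (2 : Fin 3) ((n : ℕ) : ℤ)) x).re) • EuclideanSpace.single (0 : Fin 3) (1 : ℝ))
        (u₀ j) (u j)) ∧
      (∀ j, ∫ x, u₀ j x = V • EuclideanSpace.single (2 : Fin 3) (1 : ℝ)) ∧
      (∀ j, ∃ C : ℝ, ∀ t : ℝ, 0 ≤ t → kineticEnergy (u j t) ≤ C) ∧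
      (∀ j, longTimeAvgSup (fun t => ∫ x, ⟪(F * (UnitAddTorus.mFourier (Pi.single (1 : Fin 3) ((m : ℕ) : ℤ)) x).im * (UnitAddTorus.mFourier (Pi.single (2 : Fin 3) ((n : ℕ) : ℤ)) x).re) • EuclideanSpace.single (0 : Fin 3) (1 : ℝ), u j t x⟫) ≤
        meanDissipation (ν j) (u j)) ∧
      ∀ j (t : ℝ), ∫ x, ⟪u j t x - V • EuclideanSpace.single (2 : Fin 3) (1 : ℝ),
        convect (fun y => u j t y - V • EuclideanSpace.single (2 : Fin 3) (1 : ℝ)) (fun y : UnitAddTorus (Fin 3) => ((UnitAddTorus.mFourier (Pi.single (1 : Fin 3) ((m : ℕ) : ℤ)) y).im * (UnitAddTorus.mFourier (Pi.single (2 : Fin 3) ((n : ℕ) : ℤ)) y).im) • EuclideanSpace.single (0 : Fin 3) (1 : ℝ)) x⟫ = 0 := by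
  -- the streak amplitudes and the laminar states
  set κ2 : ℝ := (2 * Real.pi) ^ 2 * ((m : ℝ) ^ 2 + (n : ℝ) ^ 2) with hκ2def
  set a : ℕ → ℝ := fun j => F * ν j * κ2 / (V ^ 2 * (2 * Real.pi * n) ^ 2 + ν j ^ 2 * κ2 ^ 2) with hadef
  set b : ℕ → ℝ := fun j => F * V * (2 * Real.pi * n) / (V ^ 2 * (2 * Real.pi * n) ^ 2 + ν j ^ 2 * κ2 ^ 2)
    with hbdef
  set r : ℕ → UnitAddTorus (Fin 3) → ℝ := fun j x => (UnitAddTorus.mFourier (Pi.single (1 : Fin 3) ((m : ℕ) : ℤ)) x).im * (a j * (UnitAddTorus.mFourier (Pi.single (2 : Fin 3) ((n : ℕ) : ℤ)) x).re + b j * (UnitAddTorus.mFourier (Pi.single (2 : Fin 3) ((n : ℕ) : ℤ)) x).im) with hrdef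
  set U : ℕ → UnitAddTorus (Fin 3) → EuclideanSpace ℝ (Fin 3) := fun j x => V • EuclideanSpace.single (2 : Fin 3) (1 : ℝ) + r j x • EuclideanSpace.single (0 : Fin 3) (1 : ℝ) with hUdef
  have hNS : ∀ j, IsClassicalNSSolutionOn univ (ν j)
      (fun _ => fun x : UnitAddTorus (Fin 3) => (F * (UnitAddTorus.mFourier (Pi.single (1 : Fin 3) ((m : ℕ) : ℤ)) x).im * (UnitAddTorus.mFourier (Pi.single (2 : Fin 3) ((n : ℕ) : ℤ)) x).re) • EuclideanSpace.single (0 : Fin 3) (1 : ℝ)) (fun _ => U j) (fun _ _ => (0 : ℝ)) ∧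
      ∫ x, U j x = V • EuclideanSpace.single (2 : Fin 3) (1 : ℝ) ∧ kineticEnergy (U j) ≤ V ^ 2 / 2 + F ^ 2 / (8 * V ^ 2 * (2 * Real.pi * n) ^ 2) :=
    fun j => dopplerClock_laminarStreaks_proof F V (ν j) m n hV (hν j) hn
  refine ⟨U, fun j _ => U j, fun j => (hNS j).1.isGlobalLerayHopf, fun j => (hNS j).2.1,
    fun j => ⟨_, fun t _ => le_rfl⟩, fun j => ?_, fun j t => ?_⟩
  · -- no leakage (with equality): `⟨(f,u_L)⟩⁺ = (f,u_L) = ν‖∇u_L‖² = meanDissipation`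
    have hsm : IsSmooth (U j) := (hNS j).1.smooth_velocity.isSmooth_slice (Set.mem_univ (0 : ℝ))
    have hE := (hNS j).1.energy_eq convex_univ (zero_le_one (α := ℝ)) (Set.subset_univ _)
    simp only [intervalIntegral.integral_const, sub_zero, one_smul] at hE
    change longTimeAvgSup (fun _ : ℝ => ∫ x, ⟪(F * (UnitAddTorus.mFourier (Pi.single (1 : Fin 3) ((m : ℕ) : ℤ)) x).im * (UnitAddTorus.mFourier (Pi.single (2 : Fin 3) ((n : ℕ) : ℤ)) x).re) • EuclideanSpace.single (0 : Fin 3) (1 : ℝ), U j x⟫) ≤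
      meanDissipation (ν j) (fun _ : ℝ => U j)
    rw [show longTimeAvgSup _ = _ from (steady_tendsto_timeMean_const _).limsup_eq,
      LaminarCalibration.meanDissipation_steady (ν j) hsm]
    linarith
  · -- the stress vanishes: `u_L − V e₂ = r e₀`
    change ∫ x, ⟪U j x - V • EuclideanSpace.single (2 : Fin 3) (1 : ℝ), convect (fun y => U j y - V • EuclideanSpace.single (2 : Fin 3) (1 : ℝ))
      (fun y : UnitAddTorus (Fin 3) => ((UnitAddTorus.mFourier (Pi.single (1 : Fin 3) ((m : ℕ) : ℤ)) y).im * (UnitAddTorus.mFourier (Pi.single (2 : Fin 3) ((n : ℕ) : ℤ)) y).im) • EuclideanSpace.single (0 : Fin 3) (1 : ℝ)) x⟫ = 0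
    have hw : (fun y => U j y - V • EuclideanSpace.single (2 : Fin 3) (1 : ℝ)) = fun y => r j y • EuclideanSpace.single (0 : Fin 3) (1 : ℝ) := by
      funext y
      simp [hUdef]
    have hw' : ∀ x, U j x - V • EuclideanSpace.single (2 : Fin 3) (1 : ℝ) = r j x • EuclideanSpace.single (0 : Fin 3) (1 : ℝ) := fun x => congrFun hw x
    simp_rw [hw']
    exact stress_streak_eq_zero m n (r j)

/-- **C1 without its floor clause is (trivially) TRUE**: clauses (i)–(v) of `QuadratureStressFloor`
are met by the drifted laminar family at `ν_j = 1/(j+1)` (any admissible design, any generalized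
limit). Recorded to certify that the hypotheses of the crux are satisfiable and that nothing but the
floor is at stake. [folklore] -/
theorem quadratureStressFloor_holds_without_floor :
    ∃ (F V : ℝ) (m n : ℕ), 0 < F ∧ 0 < V ∧ 0 < m ∧ 0 < n ∧ ∃ (_Λ : GeneralizedLimit),
      ∃ (ν : ℕ → ℝ) (u₀ : ℕ → UnitAddTorus (Fin 3) → EuclideanSpace ℝ (Fin 3)) (u : ℕ → ℝ → UnitAddTorus (Fin 3) → EuclideanSpace ℝ (Fin 3)),
        (∀ j, 0 < ν j) ∧ Tendsto ν atTop (𝓝 0) ∧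
        (∀ j, IsGlobalLerayHopf (ν j) (fun _ => fun x : UnitAddTorus (Fin 3) => (F * (UnitAddTorus.mFourier (Pi.single (1 : Fin 3) ((m : ℕ) : ℤ)) x).im * (UnitAddTorus.mFourier (Pi.single (2 : Fin 3) ((n : ℕ) : ℤ)) x).re) • EuclideanSpace.single (0 : Fin 3) (1 : ℝ))
          (u₀ j) (u j)) ∧
        (∀ j, ∫ x, u₀ j x = V • EuclideanSpace.single (2 : Fin 3) (1 : ℝ)) ∧
        (∀ j, ∃ C : ℝ, ∀ t : ℝ, 0 ≤ t → kineticEnergy (u j t) ≤ C) ∧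
        (∀ j, longTimeAvgSup (fun t => ∫ x, ⟪(F * (UnitAddTorus.mFourier (Pi.single (1 : Fin 3) ((m : ℕ) : ℤ)) x).im * (UnitAddTorus.mFourier (Pi.single (2 : Fin 3) ((n : ℕ) : ℤ)) x).re) • EuclideanSpace.single (0 : Fin 3) (1 : ℝ), u j t x⟫) ≤
          meanDissipation (ν j) (u j)) := by
  obtain ⟨Λ⟩ := (GeneralizedLimit.nonempty_holds : Nonempty GeneralizedLimit)
  have hν : ∀ j : ℕ, (0 : ℝ) < 1 / ((j : ℝ) + 1) := fun j => by positivity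
  obtain ⟨u₀, u, hLH, hmom, hsup, hnoleak, -⟩ :=
    laminar_clauses_stress_zero 1 1 1 1 one_pos one_pos (fun j => 1 / ((j : ℝ) + 1)) hν
  exact ⟨1, 1, 1, 1, one_pos, one_pos, one_pos, one_pos, Λ, fun j => 1 / ((j : ℝ) + 1), u₀, u, hν,
    tendsto_one_div_add_atTop_nhds_zero_nat, hLH, hmom, hsup, hnoleak⟩

/-- **The `∀`-families strengthening of C1 is FALSE** (even in its weakest form, with the generalized
limit and the floor allowed to depend on the family): for every admissible design the drifted laminar
family is an admissible family (clauses (i)–(v)) whose stress vanishes identically, so no `ε₀ > 0`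
bounds `−Λ⟨T_s(w_j)⟩ = 0` from below. The existential over families in C1 is essential: a proof
must SELECT loud witnesses, it cannot argue from the clauses. [folklore] -/
theorem not_quadratureStressFloor_forall_families :
    ¬ ∃ (F V : ℝ) (m n : ℕ), 0 < F ∧ 0 < V ∧ 0 < m ∧ 0 < n ∧
      ∀ (ν : ℕ → ℝ) (u₀ : ℕ → UnitAddTorus (Fin 3) → EuclideanSpace ℝ (Fin 3)) (u : ℕ → ℝ → UnitAddTorus (Fin 3) → EuclideanSpace ℝ (Fin 3)),
        (∀ j, 0 < ν j) → Tendsto ν atTop (𝓝 0) →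
        (∀ j, IsGlobalLerayHopf (ν j) (fun _ => fun x : UnitAddTorus (Fin 3) => (F * (UnitAddTorus.mFourier (Pi.single (1 : Fin 3) ((m : ℕ) : ℤ)) x).im * (UnitAddTorus.mFourier (Pi.single (2 : Fin 3) ((n : ℕ) : ℤ)) x).re) • EuclideanSpace.single (0 : Fin 3) (1 : ℝ))
          (u₀ j) (u j)) →
        (∀ j, ∫ x, u₀ j x = V • EuclideanSpace.single (2 : Fin 3) (1 : ℝ)) →
        (∀ j, ∃ C : ℝ, ∀ t : ℝ, 0 ≤ t → kineticEnergy (u j t) ≤ C) →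
        (∀ j, longTimeAvgSup (fun t => ∫ x, ⟪(F * (UnitAddTorus.mFourier (Pi.single (1 : Fin 3) ((m : ℕ) : ℤ)) x).im * (UnitAddTorus.mFourier (Pi.single (2 : Fin 3) ((n : ℕ) : ℤ)) x).re) • EuclideanSpace.single (0 : Fin 3) (1 : ℝ), u j t x⟫) ≤
          meanDissipation (ν j) (u j)) →
        ∃ (Λ : GeneralizedLimit) (ε₀ : ℝ), 0 < ε₀ ∧ ∀ j, ε₀ ≤ -Λ.longTimeAvg (fun t => ∫ x, ⟪u j t x - V • EuclideanSpace.single (2 : Fin 3) (1 : ℝ),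
          convect (fun y => u j t y - V • EuclideanSpace.single (2 : Fin 3) (1 : ℝ)) (fun y : UnitAddTorus (Fin 3) => ((UnitAddTorus.mFourier (Pi.single (1 : Fin 3) ((m : ℕ) : ℤ)) y).im * (UnitAddTorus.mFourier (Pi.single (2 : Fin 3) ((n : ℕ) : ℤ)) y).im) • EuclideanSpace.single (0 : Fin 3) (1 : ℝ)) x⟫) := by
  rintro ⟨F, V, m, n, -, hV, -, hn, hall⟩
  have hν : ∀ j : ℕ, (0 : ℝ) < 1 / ((j : ℝ) + 1) := fun j => by positivity
  obtain ⟨u₀, u, hLH, hmom, hsup, hnoleak, hzero⟩ :=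
    laminar_clauses_stress_zero F V m n hV hn (fun j => 1 / ((j : ℝ) + 1)) hν
  obtain ⟨Λ, ε₀, hε₀, hfloor⟩ :=
    hall (fun j => 1 / ((j : ℝ) + 1)) u₀ u hν tendsto_one_div_add_atTop_nhds_zero_nat hLH hmom hsup hnoleak
  have h0 := hfloor 0
  simp_rw [hzero 0] at h0
  rw [steady_longTimeAvg_const Λ 0, neg_zero] at h0
  exact absurd h0 (not_le.2 hε₀)

/-! ### (d) The frame pinning `∫ u₀ⱼ = V e₂` is load-bearing -/

/-- **C1 without the momentum pinning is TRUE, by undrifted laminar states.** Delete the single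
clause `∫ u₀ⱼ = V e₂` from `QuadratureStressFloor`; then with the design `F = V = 1`, `m = n = 1`,
`ν_j = 1/(j+1)` the UNDRIFTED steady Kolmogorov-type states `U_j = a_j Ψ_c`, `a_j = 1/(ν_j κ²)`,
`κ² = 8π²` (classical steady solutions: `νκ² a = F`, zero drift) are global Leray–Hopf, have bounded
energy and no leakage (steady energy identity), and their stress about the frame `V e₂` is
`T_s(U_j − V e₂) = −2πnV a_j ∫(sin·cos)² = −(j+1)/(16π)`, so `ε₀ = 1/(16π)` is a floor. The frame
velocity `V` of `T_s` and the momentum of the witnesses must be tied for the crux to mean anything —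
exactly the clause the work identity (item 18133) consumes. [folklore] -/
theorem quadratureStressFloor_holds_without_momentumPinning :
    ∃ (F V : ℝ) (m n : ℕ), 0 < F ∧ 0 < V ∧ 0 < m ∧ 0 < n ∧ ∃ (Λ : GeneralizedLimit),
      ∃ (ν : ℕ → ℝ) (u₀ : ℕ → UnitAddTorus (Fin 3) → EuclideanSpace ℝ (Fin 3)) (u : ℕ → ℝ → UnitAddTorus (Fin 3) → EuclideanSpace ℝ (Fin 3)),
        (∀ j, 0 < ν j) ∧ Tendsto ν atTop (𝓝 0) ∧
        (∀ j, IsGlobalLerayHopf (ν j) (fun _ => fun x : UnitAddTorus (Fin 3) => (F * (UnitAddTorus.mFourier (Pi.single (1 : Fin 3) ((m : ℕ) : ℤ)) x).im * (UnitAddTorus.mFourier (Pi.single (2 : Fin 3) ((n : ℕ) : ℤ)) x).re) • EuclideanSpace.single (0 : Fin 3) (1 : ℝ))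
          (u₀ j) (u j)) ∧
        (∀ j, ∃ C : ℝ, ∀ t : ℝ, 0 ≤ t → kineticEnergy (u j t) ≤ C) ∧
        (∀ j, longTimeAvgSup (fun t => ∫ x, ⟪(F * (UnitAddTorus.mFourier (Pi.single (1 : Fin 3) ((m : ℕ) : ℤ)) x).im * (UnitAddTorus.mFourier (Pi.single (2 : Fin 3) ((n : ℕ) : ℤ)) x).re) • EuclideanSpace.single (0 : Fin 3) (1 : ℝ), u j t x⟫) ≤
          meanDissipation (ν j) (u j)) ∧
        ∃ ε₀ : ℝ, 0 < ε₀ ∧ ∀ j, ε₀ ≤ -Λ.longTimeAvg (fun t => ∫ x, ⟪u j t x - V • EuclideanSpace.single (2 : Fin 3) (1 : ℝ),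
          convect (fun y => u j t y - V • EuclideanSpace.single (2 : Fin 3) (1 : ℝ)) (fun y : UnitAddTorus (Fin 3) => ((UnitAddTorus.mFourier (Pi.single (1 : Fin 3) ((m : ℕ) : ℤ)) y).im * (UnitAddTorus.mFourier (Pi.single (2 : Fin 3) ((n : ℕ) : ℤ)) y).im) • EuclideanSpace.single (0 : Fin 3) (1 : ℝ)) x⟫) := by
  obtain ⟨Λ⟩ := (GeneralizedLimit.nonempty_holds : Nonempty GeneralizedLimit)
  -- viscosities, amplitudes, the undrifted laminar states
  set ν : ℕ → ℝ := fun j => 1 / ((j : ℝ) + 1) with hνdef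
  have hν : ∀ j, 0 < ν j := fun j => by rw [hνdef]; positivity
  set κ2 : ℝ := (2 * Real.pi) ^ 2 * (((1 : ℕ) : ℝ) ^ 2 + ((1 : ℕ) : ℝ) ^ 2) with hκ2def
  have hκ2 : 0 < κ2 := by rw [hκ2def]; positivity
  set a : ℕ → ℝ := fun j => 1 / (ν j * κ2) with hadef
  have ha : ∀ j, 0 < a j := fun j => by rw [hadef]; exact div_pos one_pos (mul_pos (hν j) hκ2)
  set r : ℕ → UnitAddTorus (Fin 3) → ℝ := fun j x => (UnitAddTorus.mFourier (Pi.single (1 : Fin 3) ((1 : ℕ) : ℤ)) x).im * (a j * (UnitAddTorus.mFourier (Pi.single (2 : Fin 3) ((1 : ℕ) : ℤ)) x).re + 0 * (UnitAddTorus.mFourier (Pi.single (2 : Fin 3) ((1 : ℕ) : ℤ)) x).im) with hrdef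
  set U : ℕ → UnitAddTorus (Fin 3) → EuclideanSpace ℝ (Fin 3) := fun j x => (0 : ℝ) • EuclideanSpace.single (2 : Fin 3) (1 : ℝ) + r j x • EuclideanSpace.single (0 : Fin 3) (1 : ℝ) with hUdef
  have hNS : ∀ j, IsClassicalNSSolutionOn univ (ν j)
      (fun _ => fun x : UnitAddTorus (Fin 3) => ((1 : ℝ) * (UnitAddTorus.mFourier (Pi.single (1 : Fin 3) ((1 : ℕ) : ℤ)) x).im * (UnitAddTorus.mFourier (Pi.single (2 : Fin 3) ((1 : ℕ) : ℤ)) x).re) • EuclideanSpace.single (0 : Fin 3) (1 : ℝ)) (fun _ => U j) (fun _ _ => (0 : ℝ)) := by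
    intro j
    have h := DopplerStreaks.isClassicalNSSolutionOn_streaks 1 0 (ν j) (a j) 0 1 1 ?_ ?_
    · exact h
    · show 2 * Real.pi * ((1 : ℕ) : ℝ) * 0 * 0 + ν j * κ2 * (1 / (ν j * κ2)) = 1
      rw [mul_one_div, div_self (ne_of_gt (mul_pos (hν j) hκ2))]
      ring
    · ring
  -- the stress of `U_j − V e₂`, `V = 1`: a negative constant `−2π a_j / 4`
  have hstress : ∀ j, ∫ x, ⟪U j x - (1 : ℝ) • EuclideanSpace.single (2 : Fin 3) (1 : ℝ), convect (fun y => U j y - (1 : ℝ) • EuclideanSpace.single (2 : Fin 3) (1 : ℝ))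
      (fun y : UnitAddTorus (Fin 3) => ((UnitAddTorus.mFourier (Pi.single (1 : Fin 3) ((1 : ℕ) : ℤ)) y).im * (UnitAddTorus.mFourier (Pi.single (2 : Fin 3) ((1 : ℕ) : ℤ)) y).im) • EuclideanSpace.single (0 : Fin 3) (1 : ℝ)) x⟫ = -(2 * Real.pi * a j * 4⁻¹) := by
    intro j
    have hw : (fun y => U j y - (1 : ℝ) • EuclideanSpace.single (2 : Fin 3) (1 : ℝ)) = fun y => r j y • EuclideanSpace.single (0 : Fin 3) (1 : ℝ) + (-1 : ℝ) • EuclideanSpace.single (2 : Fin 3) (1 : ℝ) := by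
      funext y
      simp only [hUdef, zero_smul, zero_add, one_smul, neg_smul, sub_eq_add_neg]
    have hw' : ∀ x, U j x - (1 : ℝ) • EuclideanSpace.single (2 : Fin 3) (1 : ℝ) = r j x • EuclideanSpace.single (0 : Fin 3) (1 : ℝ) + (-1 : ℝ) • EuclideanSpace.single (2 : Fin 3) (1 : ℝ) := fun x => congrFun hw x
    simp_rw [hw', convect_streak_pattern]
    have hpt : ∀ x : UnitAddTorus (Fin 3), ⟪r j x • EuclideanSpace.single (0 : Fin 3) (1 : ℝ) + (-1 : ℝ) • EuclideanSpace.single (2 : Fin 3) (1 : ℝ),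
        (-1 : ℝ) • ((2 * Real.pi * ((1 : ℕ) : ℝ) * ((UnitAddTorus.mFourier (Pi.single (1 : Fin 3) ((1 : ℕ) : ℤ)) x).im * (UnitAddTorus.mFourier (Pi.single (2 : Fin 3) ((1 : ℕ) : ℤ)) x).re)) • EuclideanSpace.single (0 : Fin 3) (1 : ℝ))⟫ =
        (-(2 * Real.pi * a j)) * ⟪((1 : ℝ) * (UnitAddTorus.mFourier (Pi.single (1 : Fin 3) ((1 : ℕ) : ℤ)) x).im * (UnitAddTorus.mFourier (Pi.single (2 : Fin 3) ((1 : ℕ) : ℤ)) x).re) • EuclideanSpace.single (0 : Fin 3) (1 : ℝ),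
          ((UnitAddTorus.mFourier (Pi.single (1 : Fin 3) ((1 : ℕ) : ℤ)) x).im * (UnitAddTorus.mFourier (Pi.single (2 : Fin 3) ((1 : ℕ) : ℤ)) x).re) • EuclideanSpace.single (0 : Fin 3) (1 : ℝ)⟫ := by
      intro x
      simp only [hrdef, inner_add_left, inner_smul_left, inner_smul_right,
        EuclideanSpace.inner_single_right, PiLp.single_apply]
      simp
      ring
    simp_rw [hpt]
    rw [integral_const_mul, LongitudinalQuiet.integral_inner_force_copattern 1 1 one_ne_zero]
    simp
  -- assemble
  refine ⟨1, 1, 1, 1, one_pos, one_pos, one_pos, one_pos, Λ, ν, U, fun j _ => U j, hν,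
    tendsto_one_div_add_atTop_nhds_zero_nat, fun j => ?_, fun j => ⟨_, fun t _ => le_rfl⟩, fun j => ?_,
    2 * Real.pi * 4⁻¹ / κ2, by positivity, fun j => ?_⟩
  · -- Leray–Hopf
    exact (hNS j).isGlobalLerayHopf
  · -- no leakage (equality), as for the drifted laminar family
    have hsm : IsSmooth (U j) := (hNS j).smooth_velocity.isSmooth_slice (Set.mem_univ (0 : ℝ))
    have hE := (hNS j).energy_eq convex_univ (zero_le_one (α := ℝ)) (Set.subset_univ _)
    simp only [intervalIntegral.integral_const, sub_zero, one_smul] at hE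
    change longTimeAvgSup (fun _ : ℝ => ∫ x, ⟪((1 : ℝ) * (UnitAddTorus.mFourier (Pi.single (1 : Fin 3) ((1 : ℕ) : ℤ)) x).im * (UnitAddTorus.mFourier (Pi.single (2 : Fin 3) ((1 : ℕ) : ℤ)) x).re) • EuclideanSpace.single (0 : Fin 3) (1 : ℝ), U j x⟫) ≤
      meanDissipation (ν j) (fun _ : ℝ => U j)
    rw [show longTimeAvgSup _ = _ from (steady_tendsto_timeMean_const _).limsup_eq,
      LaminarCalibration.meanDissipation_steady (ν j) hsm]
    linarith
  · -- the floor: `−T_s = 2π a_j/4 = 2π/(4 ν_j κ²) ≥ 2π/(4κ²)` since `ν_j ≤ 1`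
    change 2 * Real.pi * 4⁻¹ / κ2 ≤ -Λ.longTimeAvg (fun _ : ℝ => ∫ x, ⟪U j x - (1 : ℝ) • EuclideanSpace.single (2 : Fin 3) (1 : ℝ),
      convect (fun y => U j y - (1 : ℝ) • EuclideanSpace.single (2 : Fin 3) (1 : ℝ)) (fun y : UnitAddTorus (Fin 3) => ((UnitAddTorus.mFourier (Pi.single (1 : Fin 3) ((1 : ℕ) : ℤ)) y).im * (UnitAddTorus.mFourier (Pi.single (2 : Fin 3) ((1 : ℕ) : ℤ)) y).im) • EuclideanSpace.single (0 : Fin 3) (1 : ℝ)) x⟫)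
    rw [hstress j, steady_longTimeAvg_const, neg_neg, hadef]
    have hνle : ν j ≤ 1 := by
      rw [hνdef]
      rw [div_le_one (by positivity)]
      linarith [(Nat.cast_nonneg j : (0 : ℝ) ≤ j)]
    rw [div_le_iff₀ hκ2]
    have : 2 * Real.pi * (1 / (ν j * κ2)) * 4⁻¹ * κ2 = 2 * Real.pi * 4⁻¹ / ν j := by
      field_simp
    rw [this, le_div_iff₀ (hν j)]
    nlinarith [Real.pi_pos, hνle]

/-! ### (e) The guards `0 < m`, `0 < n`: degenerate patterns -/

/-- At `m = 0` the streak pattern `Ψ_s = sin(2π·0·x₁) sin(2πn x₂) e₀` vanishes identically, so the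
quadrature stress of EVERY field is zero at every time. [folklore] -/
theorem stress_eq_zero_of_m_eq_zero (n : ℕ) (V : ℝ) (v : UnitAddTorus (Fin 3) → EuclideanSpace ℝ (Fin 3)) :
    ∫ x, ⟪v x - V • EuclideanSpace.single (2 : Fin 3) (1 : ℝ), convect (fun y => v y - V • EuclideanSpace.single (2 : Fin 3) (1 : ℝ))
      (fun y : UnitAddTorus (Fin 3) => ((UnitAddTorus.mFourier (Pi.single (1 : Fin 3) ((0 : ℕ) : ℤ)) y).im * (UnitAddTorus.mFourier (Pi.single (2 : Fin 3) ((n : ℕ) : ℤ)) y).im) • EuclideanSpace.single (0 : Fin 3) (1 : ℝ)) x⟫ = 0 := by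
  have hΨ : (fun y : UnitAddTorus (Fin 3) => ((UnitAddTorus.mFourier (Pi.single (1 : Fin 3) ((0 : ℕ) : ℤ)) y).im * (UnitAddTorus.mFourier (Pi.single (2 : Fin 3) ((n : ℕ) : ℤ)) y).im) • EuclideanSpace.single (0 : Fin 3) (1 : ℝ)) = fun _ => (0 : EuclideanSpace ℝ (Fin 3)) := by
    funext y
    simp [UnitAddTorus.mFourier_zero]
  rw [hΨ]
  simp [convect_fun_const]

/-- At `n = 0` the streak pattern `Ψ_s = sin(2πm x₁) sin(2π·0·x₂) e₀` vanishes identically, so the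
quadrature stress of EVERY field is zero at every time. [folklore] -/
theorem stress_eq_zero_of_n_eq_zero (m : ℕ) (V : ℝ) (v : UnitAddTorus (Fin 3) → EuclideanSpace ℝ (Fin 3)) :
    ∫ x, ⟪v x - V • EuclideanSpace.single (2 : Fin 3) (1 : ℝ), convect (fun y => v y - V • EuclideanSpace.single (2 : Fin 3) (1 : ℝ))
      (fun y : UnitAddTorus (Fin 3) => ((UnitAddTorus.mFourier (Pi.single (1 : Fin 3) ((m : ℕ) : ℤ)) y).im * (UnitAddTorus.mFourier (Pi.single (2 : Fin 3) ((0 : ℕ) : ℤ)) y).im) • EuclideanSpace.single (0 : Fin 3) (1 : ℝ)) x⟫ = 0 := by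
  have hΨ : (fun y : UnitAddTorus (Fin 3) => ((UnitAddTorus.mFourier (Pi.single (1 : Fin 3) ((m : ℕ) : ℤ)) y).im * (UnitAddTorus.mFourier (Pi.single (2 : Fin 3) ((0 : ℕ) : ℤ)) y).im) • EuclideanSpace.single (0 : Fin 3) (1 : ℝ)) = fun _ => (0 : EuclideanSpace ℝ (Fin 3)) := by
    funext y
    simp [UnitAddTorus.mFourier_zero]
  rw [hΨ]
  simp [convect_fun_const]

/-- **The matrix of C1 is false at `m = 0`** (every `F`, `V`, `n`, `Λ`, every family): the floor clause
alone is unsatisfiable because `T_s ≡ 0`. The guard `0 < m` is necessary, not cosmetic (at `m = 0`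
the force vanishes too). [folklore] -/
theorem not_stressFloor_of_m_eq_zero (n : ℕ) (V : ℝ) (Λ : GeneralizedLimit) (u : ℕ → ℝ → UnitAddTorus (Fin 3) → EuclideanSpace ℝ (Fin 3)) :
    ¬ ∃ ε₀ : ℝ, 0 < ε₀ ∧ ∀ j, ε₀ ≤ -Λ.longTimeAvg (fun t => ∫ x, ⟪u j t x - V • EuclideanSpace.single (2 : Fin 3) (1 : ℝ),
      convect (fun y => u j t y - V • EuclideanSpace.single (2 : Fin 3) (1 : ℝ)) (fun y : UnitAddTorus (Fin 3) => ((UnitAddTorus.mFourier (Pi.single (1 : Fin 3) ((0 : ℕ) : ℤ)) y).im * (UnitAddTorus.mFourier (Pi.single (2 : Fin 3) ((n : ℕ) : ℤ)) y).im) • EuclideanSpace.single (0 : Fin 3) (1 : ℝ)) x⟫) := by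
  rintro ⟨ε₀, hε₀, hfloor⟩
  have h0 := hfloor 0
  simp_rw [stress_eq_zero_of_m_eq_zero] at h0
  rw [steady_longTimeAvg_const Λ 0, neg_zero] at h0
  exact absurd h0 (not_le.2 hε₀)

/-- **The matrix of C1 is false at `n = 0`** (every `F`, `V`, `m`, `Λ`, every family): `T_s ≡ 0`.
The guard `0 < n` is necessary (at `n = 0` the force `F sin(2πm x₁) e₀` is a genuine Kolmogorov
force, but the quadrature pattern and the Doppler clock `2πnV` degenerate). [folklore] -/
theorem not_stressFloor_of_n_eq_zero (m : ℕ) (V : ℝ) (Λ : GeneralizedLimit) (u : ℕ → ℝ → UnitAddTorus (Fin 3) → EuclideanSpace ℝ (Fin 3)) :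
    ¬ ∃ ε₀ : ℝ, 0 < ε₀ ∧ ∀ j, ε₀ ≤ -Λ.longTimeAvg (fun t => ∫ x, ⟪u j t x - V • EuclideanSpace.single (2 : Fin 3) (1 : ℝ),
      convect (fun y => u j t y - V • EuclideanSpace.single (2 : Fin 3) (1 : ℝ)) (fun y : UnitAddTorus (Fin 3) => ((UnitAddTorus.mFourier (Pi.single (1 : Fin 3) ((m : ℕ) : ℤ)) y).im * (UnitAddTorus.mFourier (Pi.single (2 : Fin 3) ((0 : ℕ) : ℤ)) y).im) • EuclideanSpace.single (0 : Fin 3) (1 : ℝ)) x⟫) := by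
  rintro ⟨ε₀, hε₀, hfloor⟩
  have h0 := hfloor 0
  simp_rw [stress_eq_zero_of_n_eq_zero] at h0
  rw [steady_longTimeAvg_const Λ 0, neg_zero] at h0
  exact absurd h0 (not_le.2 hε₀)

end Summit.AnomalousDissipation.AnomalousDissipation.Cruxes.QuadratureStressFloor.Disproof.Landed

end

noncomputable section

set_option linter.dupNamespace false

open MeasureTheory Filter Topology
open Literature.Analysis.FunctionSpaces Literature.Analysis.FunctionSpaces.Torus
open Literature.Analysis.FluidPDE Literature.Analysis.FluidPDE.Torus
open Summit.AnomalousDissipation.AnomalousDissipation.Theses.DopplerClock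
open Summit.AnomalousDissipation.AnomalousDissipation.Theorems

namespace Summit.AnomalousDissipation.AnomalousDissipation.Cruxes.QuadratureStressFloor.Disproof

/-! ## (a) Load-bearing analysis -/

/-- C1 with the momentum pinning `∀ j, ∫ u₀ⱼ = V e₂` DELETED (everything else verbatim). -/
def QuadratureStressFloorWithoutMomentumPinning : Prop :=
  ∃ (F V : ℝ) (m n : ℕ), 0 < F ∧ 0 < V ∧ 0 < m ∧ 0 < n ∧ ∃ (Λ : GeneralizedLimit), ∃ (ν : ℕ → ℝ) (u₀ : ℕ → UnitAddTorus (Fin 3) → EuclideanSpace ℝ (Fin 3)) (u : ℕ → ℝ → UnitAddTorus (Fin 3) → EuclideanSpace ℝ (Fin 3)),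
    (∀ j, 0 < ν j) ∧ Filter.Tendsto ν Filter.atTop (nhds 0) ∧ (∀ j, IsGlobalLerayHopf (ν j) (fun _ => (fun (x : UnitAddTorus (Fin 3)) => (F * (UnitAddTorus.mFourier (Pi.single (1 : Fin 3) (m : ℤ)) x).im * (UnitAddTorus.mFourier (Pi.single (2 : Fin 3) (n : ℤ)) x).re) • EuclideanSpace.single (0 : Fin 3) (1 : ℝ))) (u₀ j) (u j)) ∧ (∀ j, ∃ C : ℝ, ∀ t : ℝ, 0 ≤ t → kineticEnergy (u j t) ≤ C) ∧ (∀ j, longTimeAvgSup (fun t => ∫ x, inner ℝ ((F * (UnitAddTorus.mFourier (Pi.single (1 : Fin 3) (m : ℤ)) x).im * (UnitAddTorus.mFourier (Pi.single (2 : Fin 3) (n : ℤ)) x).re) • EuclideanSpace.single (0 : Fin 3) (1 : ℝ)) (u j t x)) ≤ meanDissipation (ν j) (u j)) ∧ ∃ ε₀ : ℝ, 0 < ε₀ ∧ ∀ j, ε₀ ≤ -Λ.longTimeAvg (fun t => ∫ x, inner ℝ (u j t x - V • EuclideanSpace.single (2 : Fin 3) (1 : ℝ)) (convect (fun y => u j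 t y - V • EuclideanSpace.single (2 : Fin 3) (1 : ℝ)) (fun (y : UnitAddTorus (Fin 3)) => ((UnitAddTorus.mFourier (Pi.single (1 : Fin 3) (m : ℤ)) y).im * (UnitAddTorus.mFourier (Pi.single (2 : Fin 3) (n : ℤ)) y).im) • EuclideanSpace.single (0 : Fin 3) (1 : ℝ)) x))

/-- **The momentum pinning is load-bearing: without it C1 is (trivially) TRUE.**  Witness: the
UNDRIFTED laminar Kolmogorov-type states `U_j = (F/(ν_jκ²)) Ψ_c` of the design `F = V = 1`,
`m = n = 1`, `ν_j = 1/(j+1)`, for which `−T_s(U_j − V e₂) = (j+1)/(16π)`.  So the floor functional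
only measures the frame/momentum mismatch unless the two are tied; a proof of C1 must produce
witnesses whose momentum really is `V e₂` (the clause the work identity 18133 consumes), and a
disproof cannot come from the floor functional alone. (`Landed.quadratureStressFloor_holds_without_momentumPinning`, p172503.) -/
theorem quadratureStressFloorWithoutMomentumPinning_holds : QuadratureStressFloorWithoutMomentumPinning :=
  Landed.quadratureStressFloor_holds_without_momentumPinning

/-- C1 with its ∃ ε₀ : ℝ, 0 < ε₀ ∧ ∀ j, ε₀ ≤ -Λ.longTimeAvg (fun t => ∫ x, inner ℝ (u j t x - V • EuclideanSpace.single (2 : Fin 3) (1 : ℝ)) (convect (fun y => u j t y - V • EuclideanSpace.single (2 : Fin 3) (1 : ℝ)) (fun (y : UnitAddTorus (Fin 3)) => ((UnitAddTorus.mFourier (Pi.single (1 : Fin 3) (m : ℤ)) y).im * (UnitAddTorus.mFourier (Pi.single (2 : Fin 3) (n : ℤ)) y).im) • EuclideanSpace.single (0 : Fin 3) (1 : ℝ)) x)) clause deleted: clauses (i)–(v) only. -/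
def QuadratureStressFloorWithoutFloor : Prop :=
  ∃ (F V : ℝ) (m n : ℕ), 0 < F ∧ 0 < V ∧ 0 < m ∧ 0 < n ∧ ∃ (_Λ : GeneralizedLimit), ∃ (ν : ℕ → ℝ) (u₀ : ℕ → UnitAddTorus (Fin 3) → EuclideanSpace ℝ (Fin 3)) (u : ℕ → ℝ → UnitAddTorus (Fin 3) → EuclideanSpace ℝ (Fin 3)),
    (∀ j, 0 < ν j) ∧ Filter.Tendsto ν Filter.atTop (nhds 0) ∧ (∀ j, IsGlobalLerayHopf (ν j) (fun _ => (fun (x : UnitAddTorus (Fin 3)) => (F * (UnitAddTorus.mFourier (Pi.single (1 : Fin 3) (m : ℤ)) x).im * (UnitAddTorus.mFourier (Pi.single (2 : Fin 3) (n : ℤ)) x).re) • EuclideanSpace.single (0 : Fin 3) (1 : ℝ))) (u₀ j) (u j)) ∧ (∀ j, ∫ x, u₀ j x = V • EuclideanSpace.single (2 : Fin 3) (1 : ℝ)) ∧ (∀ j, ∃ C : ℝ, ∀ t : ℝ, 0 ≤ t → kineticEnergy (u j t) ≤ C) ∧ (∀ j, longTimeAvgSup (fun t => ∫ x, inner ℝ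 ((F * (UnitAddTorus.mFourier (Pi.single (1 : Fin 3) (m : ℤ)) x).im * (UnitAddTorus.mFourier (Pi.single (2 : Fin 3) (n : ℤ)) x).re) • EuclideanSpace.single (0 : Fin 3) (1 : ℝ)) (u j t x)) ≤ meanDissipation (ν j) (u j))

/-- **Clauses (i)–(v) are jointly satisfiable (by the drifted laminar family) — the floor is the whole
content of C1.**  In particular C1 is not vacuous and no contradiction can be derived from the
clauses alone. (`Landed.quadratureStressFloor_holds_without_floor`, p172503.) -/
theorem quadratureStressFloorWithoutFloor_holds : QuadratureStressFloorWithoutFloor :=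
  Landed.quadratureStressFloor_holds_without_floor

/-! Remarks (not cheaply decidable, recorded for the record):
* WITHOUT the Leray–Hopf clause the statement is trivially true (non-solutions), uninformative.
* WITHOUT no-leak (iv) or WITHOUT `ν_j → 0` the statement still asks for LOUD drift-`V` objects with a
  stress floor; neither deletion makes it cheaply true or false (a fixed-`ν` turbulent Kolmogorov-type
  state with `−Λ⟨T_s⟩ > 0` would do for the latter — plausible, not in the tree).
* WITHOUT the per-`j` energy clause (v′) `Λ` may act on unbounded Cesàro means (junk values), but the
  Leray–Hopf energy inequality already bounds `sup_t E` on every `[0,T]`; only `T → ∞` growth is freed. -/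

/-! ## (b) Tightness: the stress floor is a dissipation floor -/

/-- **Any C1 witness family dissipates at a `ν`-uniform rate**: clause by clause, for every member,
`ε₀ ≤ −Λ⟨T_s(w_j)⟩ ≤ (2πnV/F + κ²/(8π²)) · meanDissipation ν_j u_j + ν_j κ²/2`.  So along a witness
family `liminf_j meanDissipation ν_j u_j ≥ ε₀ / (2πnV/F + κ²/(8π²)) > 0`: C1 witnesses ARE anomalously
dissipating families (the quantitative, per-witness form of the landed iff). (`Landed.neg_longTimeAvg_stress_le`, p172446.) -/
theorem stressFloor_forces_dissipationFloor (Λ : GeneralizedLimit) {F V : ℝ} {m n : ℕ}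
    {ν : ℕ → ℝ} {u₀ : ℕ → UnitAddTorus (Fin 3) → EuclideanSpace ℝ (Fin 3)} {u : ℕ → ℝ → UnitAddTorus (Fin 3) → EuclideanSpace ℝ (Fin 3)}
    (hF : 0 < F) (hV : 0 < V) (hm : 0 < m) (hn : 0 < n) (hν : ∀ j, 0 < ν j)
    (hLH : ∀ j, IsGlobalLerayHopf (ν j) (fun _ => (fun (x : UnitAddTorus (Fin 3)) => (F * (UnitAddTorus.mFourier (Pi.single (1 : Fin 3) (m : ℤ)) x).im * (UnitAddTorus.mFourier (Pi.single (2 : Fin 3) (n : ℤ)) x).re) • EuclideanSpace.single (0 : Fin 3) (1 : ℝ))) (u₀ j) (u j))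
    (hmom : ∀ j, ∫ x, u₀ j x = V • EuclideanSpace.single (2 : Fin 3) (1 : ℝ))
    (hsup : ∀ j, ∃ C : ℝ, ∀ t : ℝ, 0 ≤ t → kineticEnergy (u j t) ≤ C)
    (hnoleak : ∀ j, longTimeAvgSup (fun t => ∫ x, inner ℝ ((F * (UnitAddTorus.mFourier (Pi.single (1 : Fin 3) (m : ℤ)) x).im * (UnitAddTorus.mFourier (Pi.single (2 : Fin 3) (n : ℤ)) x).re) • EuclideanSpace.single (0 : Fin 3) (1 : ℝ)) (u j t x)) ≤ meanDissipation (ν j) (u j))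
    {ε₀ : ℝ} (hfloor : ∀ j, ε₀ ≤ -Λ.longTimeAvg (fun t => ∫ x, inner ℝ (u j t x - V • EuclideanSpace.single (2 : Fin 3) (1 : ℝ)) (convect (fun y => u j t y - V • EuclideanSpace.single (2 : Fin 3) (1 : ℝ)) (fun (y : UnitAddTorus (Fin 3)) => ((UnitAddTorus.mFourier (Pi.single (1 : Fin 3) (m : ℤ)) y).im * (UnitAddTorus.mFourier (Pi.single (2 : Fin 3) (n : ℤ)) y).im) • EuclideanSpace.single (0 : Fin 3) (1 : ℝ)) x))) (j : ℕ) :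
    ε₀ ≤ (V * (2 * Real.pi * n) / F + (2 * Real.pi) ^ 2 * ((m : ℝ) ^ 2 + (n : ℝ) ^ 2) / (8 * Real.pi ^ 2)) *
        meanDissipation (ν j) (u j) + ν j * ((2 * Real.pi) ^ 2 * ((m : ℝ) ^ 2 + (n : ℝ) ^ 2)) / 2 :=
  (hfloor j).trans (Landed.neg_longTimeAvg_stress_le Λ hF hV (hν j) hm hn (hLH j) (hmom j) (hsup j) (hnoleak j))

/-- **Dormant families carry no floor**: if `meanDissipation ν_j u_j → 0` along a family meeting
clauses (i)–(v), then for every `ε₀ > 0` some member has `−Λ⟨T_s(w_j)⟩ < ε₀`.  Kills, as C1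
witnesses: laminar and relaminarising families, every `O(ν)`- or `o(1)`-dissipating class, and — were
it ever proved — any force-specific "no anomalous dissipation" theorem would kill C1 outright.
(`Landed.exists_neg_longTimeAvg_stress_lt_of_dormant`, p172446.) -/
theorem no_floor_of_dormant (Λ : GeneralizedLimit) {F V : ℝ} {m n : ℕ}
    {ν : ℕ → ℝ} {u₀ : ℕ → UnitAddTorus (Fin 3) → EuclideanSpace ℝ (Fin 3)} {u : ℕ → ℝ → UnitAddTorus (Fin 3) → EuclideanSpace ℝ (Fin 3)}
    (hF : 0 < F) (hV : 0 < V) (hm : 0 < m) (hn : 0 < n) (hν : ∀ j, 0 < ν j)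
    (hν0 : Tendsto ν atTop (𝓝 0))
    (hLH : ∀ j, IsGlobalLerayHopf (ν j) (fun _ => (fun (x : UnitAddTorus (Fin 3)) => (F * (UnitAddTorus.mFourier (Pi.single (1 : Fin 3) (m : ℤ)) x).im * (UnitAddTorus.mFourier (Pi.single (2 : Fin 3) (n : ℤ)) x).re) • EuclideanSpace.single (0 : Fin 3) (1 : ℝ))) (u₀ j) (u j))
    (hmom : ∀ j, ∫ x, u₀ j x = V • EuclideanSpace.single (2 : Fin 3) (1 : ℝ))
    (hsup : ∀ j, ∃ C : ℝ, ∀ t : ℝ, 0 ≤ t → kineticEnergy (u j t) ≤ C)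
    (hnoleak : ∀ j, longTimeAvgSup (fun t => ∫ x, inner ℝ ((F * (UnitAddTorus.mFourier (Pi.single (1 : Fin 3) (m : ℤ)) x).im * (UnitAddTorus.mFourier (Pi.single (2 : Fin 3) (n : ℤ)) x).re) • EuclideanSpace.single (0 : Fin 3) (1 : ℝ)) (u j t x)) ≤ meanDissipation (ν j) (u j))
    (hdormant : Tendsto (fun j => meanDissipation (ν j) (u j)) atTop (𝓝 0)) {ε₀ : ℝ} (hε₀ : 0 < ε₀) :
    ∃ j, -Λ.longTimeAvg (fun t => ∫ x, inner ℝ (u j t x - V • EuclideanSpace.single (2 : Fin 3) (1 : ℝ)) (convect (fun y => u j t y - V • EuclideanSpace.single (2 : Fin 3) (1 : ℝ)) (fun (y : UnitAddTorus (Fin 3)) => ((UnitAddTorus.mFourier (Pi.single (1 : Fin 3) (m : ℤ)) y).im * (UnitAddTorus.mFourier (Pi.single (2 : Fin 3) (n : ℤ)) y).im) • EuclideanSpace.single (0 : Fin 3) (1 : ℝ)) x)) < ε₀ :=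
  Landed.exists_neg_longTimeAvg_stress_lt_of_dormant Λ hF hV hm hn hν hν0 hLH hmom hsup hnoleak hdormant hε₀

/-! ## (c) Natural strengthenings, refuted -/

/-- The `∀`-families strengthening of C1 (weakest form: `Λ`, `ε₀` may depend on the family). -/
def QuadratureStressFloorForallFamilies : Prop :=
  ∃ (F V : ℝ) (m n : ℕ), 0 < F ∧ 0 < V ∧ 0 < m ∧ 0 < n ∧
    ∀ (ν : ℕ → ℝ) (u₀ : ℕ → UnitAddTorus (Fin 3) → EuclideanSpace ℝ (Fin 3)) (u : ℕ → ℝ → UnitAddTorus (Fin 3) → EuclideanSpace ℝ (Fin 3)),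
      (∀ j, 0 < ν j) → Filter.Tendsto ν Filter.atTop (nhds 0) → (∀ j, IsGlobalLerayHopf (ν j) (fun _ => (fun (x : UnitAddTorus (Fin 3)) => (F * (UnitAddTorus.mFourier (Pi.single (1 : Fin 3) (m : ℤ)) x).im * (UnitAddTorus.mFourier (Pi.single (2 : Fin 3) (n : ℤ)) x).re) • EuclideanSpace.single (0 : Fin 3) (1 : ℝ))) (u₀ j) (u j)) → (∀ j, ∫ x, u₀ j x = V • EuclideanSpace.single (2 : Fin 3) (1 : ℝ)) → (∀ j, ∃ C : ℝ, ∀ t : ℝ, 0 ≤ t → kineticEnergy (u j t) ≤ C) → (∀ j, longTimeAvgSup (fun t => ∫ x, inner ℝ ((F * (UnitAddTorus.mFourier (Pi.single (1 : Fin 3) (m : ℤ)) x).im * (UnitAddTorus.mFourier (Pi.single (2 : Fin 3) (n : ℤ)) x).re) • EuclideanSpace.single (0 : Fin 3) (1 : ℝ)) (u j t x)) ≤ meanDissipation (ν j) (u j)) →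
      ∃ (Λ : GeneralizedLimit) (ε₀ : ℝ), 0 < ε₀ ∧ ∀ j, ε₀ ≤ -Λ.longTimeAvg (fun t => ∫ x, inner ℝ (u j t x - V • EuclideanSpace.single (2 : Fin 3) (1 : ℝ)) (convect (fun y => u j t y - V • EuclideanSpace.single (2 : Fin 3) (1 : ℝ)) (fun (y : UnitAddTorus (Fin 3)) => ((UnitAddTorus.mFourier (Pi.single (1 : Fin 3) (m : ℤ)) y).im * (UnitAddTorus.mFourier (Pi.single (2 : Fin 3) (n : ℤ)) y).im) • EuclideanSpace.single (0 : Fin 3) (1 : ℝ)) x))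

/-- **FALSE**: the drifted laminar family meets (i)–(v) with `T_s ≡ 0` for every design.  A proof of
C1 must SELECT loud witnesses; it cannot argue from the clauses. (`Landed.not_quadratureStressFloor_forall_families`, p172503.) -/
theorem not_QuadratureStressFloorForallFamilies : ¬ QuadratureStressFloorForallFamilies :=
  Landed.not_quadratureStressFloor_forall_families

/-- C1 restricted to `x₀`-INVARIANT classical witnesses on `[0, ∞)` (streak arrays, their transients,
any streamwise-independent state), datum `u_j 0`. -/
def QuadratureStressFloorLongitudinal : Prop :=
  ∃ (F V : ℝ) (m n : ℕ), 0 < F ∧ 0 < V ∧ 0 < m ∧ 0 < n ∧ ∃ (Λ : GeneralizedLimit),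
    ∃ (ν : ℕ → ℝ) (u : ℕ → ℝ → UnitAddTorus (Fin 3) → EuclideanSpace ℝ (Fin 3)) (p : ℕ → ℝ → UnitAddTorus (Fin 3) → ℝ),
      (∀ j, 0 < ν j) ∧ Filter.Tendsto ν Filter.atTop (nhds 0) ∧
      (∀ j, IsClassicalNSSolutionOn (Set.Ici 0) (ν j) (fun _ => (fun (x : UnitAddTorus (Fin 3)) => (F * (UnitAddTorus.mFourier (Pi.single (1 : Fin 3) (m : ℤ)) x).im * (UnitAddTorus.mFourier (Pi.single (2 : Fin 3) (n : ℤ)) x).re) • EuclideanSpace.single (0 : Fin 3) (1 : ℝ))) (u j) (p j)) ∧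
      (∀ j (t : ℝ) (c : UnitAddCircle) (x : UnitAddTorus (Fin 3)), u j t (x + Pi.single (0 : Fin 3) c) = u j t x) ∧
      (∀ j, ∫ x, u j 0 x = V • EuclideanSpace.single (2 : Fin 3) (1 : ℝ)) ∧ (∀ j, ∃ C : ℝ, ∀ t : ℝ, 0 ≤ t → kineticEnergy (u j t) ≤ C) ∧ (∀ j, longTimeAvgSup (fun t => ∫ x, inner ℝ ((F * (UnitAddTorus.mFourier (Pi.single (1 : Fin 3) (m : ℤ)) x).im * (UnitAddTorus.mFourier (Pi.single (2 : Fin 3) (n : ℤ)) x).re) • EuclideanSpace.single (0 : Fin 3) (1 : ℝ)) (u j t x)) ≤ meanDissipation (ν j) (u j)) ∧ ∃ ε₀ : ℝ, 0 < ε₀ ∧ ∀ j, ε₀ ≤ -Λ.longTimeAvg (fun t => ∫ x, inner ℝ (u j t x - V • EuclideanSpace.single (2 : Fin 3) (1 : ℝ)) (convect (fun y => u j t y - V • EuclideanSpace.single (2 : Fin 3) (1 : ℝ)) (fun (y : UnitAddTorus (Fin 3)) => ((UnitAddTorus.mFourier (Pi.single (1 : Fin 3) (m : ℤ)) y).im *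 (UnitAddTorus.mFourier (Pi.single (2 : Fin 3) (n : ℤ)) y).im) • EuclideanSpace.single (0 : Fin 3) (1 : ℝ)) x))

/-- **FALSE**: the longitudinal class is quiet (item 18134, dissipation `≤ ν κ²F²/(4V²(2πn)²)`), so by
(b) it has no floor.  Every C1 witness must break the streamwise symmetry of force and pattern.
(`Landed.not_quadratureStressFloor_longitudinalClass`, p172446.) -/
theorem not_QuadratureStressFloorLongitudinal : ¬ QuadratureStressFloorLongitudinal :=
  Landed.not_quadratureStressFloor_longitudinalClass

/-- **Guard `0 < m` is necessary**: at `m = 0` the pattern vanishes, `T_s ≡ 0`, and the floor clause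
fails for every `V`, `Λ`, family. (`Landed.not_stressFloor_of_m_eq_zero`, p172503.) -/
theorem not_floor_at_m_zero (n : ℕ) (V : ℝ) (Λ : GeneralizedLimit) (u : ℕ → ℝ → UnitAddTorus (Fin 3) → EuclideanSpace ℝ (Fin 3)) :
    ¬ ∃ ε₀ : ℝ, 0 < ε₀ ∧ ∀ j, ε₀ ≤ -Λ.longTimeAvg (fun t => ∫ x, inner ℝ (u j t x - V • EuclideanSpace.single (2 : Fin 3) (1 : ℝ))
      (convect (fun y => u j t y - V • EuclideanSpace.single (2 : Fin 3) (1 : ℝ)) (fun (y : UnitAddTorus (Fin 3)) => ((UnitAddTorus.mFourier (Pi.single (1 : Fin 3) ((0 : ℕ) : ℤ)) y).im * (UnitAddTorus.mFourier (Pi.single (2 : Fin 3) (n : ℤ)) y).im) • EuclideanSpace.single (0 : Fin 3) (1 : ℝ)) x)) :=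
  Landed.not_stressFloor_of_m_eq_zero n V Λ u

/-- **Guard `0 < n` is necessary**: at `n = 0` the pattern vanishes, `T_s ≡ 0`.
(`Landed.not_stressFloor_of_n_eq_zero`, p172503.) -/
theorem not_floor_at_n_zero (m : ℕ) (V : ℝ) (Λ : GeneralizedLimit) (u : ℕ → ℝ → UnitAddTorus (Fin 3) → EuclideanSpace ℝ (Fin 3)) :
    ¬ ∃ ε₀ : ℝ, 0 < ε₀ ∧ ∀ j, ε₀ ≤ -Λ.longTimeAvg (fun t => ∫ x, inner ℝ (u j t x - V • EuclideanSpace.single (2 : Fin 3) (1 : ℝ))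
      (convect (fun y => u j t y - V • EuclideanSpace.single (2 : Fin 3) (1 : ℝ)) (fun (y : UnitAddTorus (Fin 3)) => ((UnitAddTorus.mFourier (Pi.single (1 : Fin 3) (m : ℤ)) y).im * (UnitAddTorus.mFourier (Pi.single (2 : Fin 3) ((0 : ℕ) : ℤ)) y).im) • EuclideanSpace.single (0 : Fin 3) (1 : ℝ)) x)) :=
  Landed.not_stressFloor_of_n_eq_zero m V Λ u

/-! ## (d) Targets / lines

-- Targets: none served this cycle (payload.targets = [], stuck_stubs = []).
-- Line Sketch (PICKED, lead c2): `QuadratureStressFloor_of := stub_bridgeEnergyFreeInjectionFloor ∘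
--   stub_loudPeriodicWitnessesEnergyFree`; the bridge is PROVED (p168484) and is an `iff`
--   (`lineSketch_coreStub_iff_crux` below), so the only open stub IS the crux: no stub weaker than C1
--   exists on this line, nothing for a disprover to kill short of `¬ C1`.  Lead c2 declared the line
--   dead-as-identical (`Lines/Sketch-dead.md`).
-- Line steady-pitchfork-branch (registered, not picked): core `stub_quietRigidity` (every non-laminar
--   R₂-symmetric steady drift state of the pinned design (m,n)=(1,2) with ν(Ψ_s,u)² ≤ 1 dissipates ≥ ε)
--   is killable by ONE quiet such state; that is a hookstep/Newton continuation job (j023495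
--   inconclusive), to be run only if the line is picked.  By (b) a quiet steady state has no stress
--   floor either (steady ⇒ Cesàro means constant, any Λ). -/

/-- The core stub of line `Sketch` is the crux: energy-free injection floor ⟺ C1 (p168484). -/
theorem lineSketch_coreStub_iff_crux :
    QuadratureStressFloor ↔
    (∃ (F V : ℝ) (m n : ℕ), 0 < F ∧ 0 < V ∧ 0 < m ∧ 0 < n ∧ ∃ (Λ : GeneralizedLimit), ∃ (ν : ℕ → ℝ) (u₀ : ℕ → UnitAddTorus (Fin 3) → EuclideanSpace ℝ (Fin 3)) (u : ℕ → ℝ → UnitAddTorus (Fin 3) → EuclideanSpace ℝ (Fin 3)),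
      (∀ j, 0 < ν j) ∧ Filter.Tendsto ν Filter.atTop (nhds 0) ∧ (∀ j, IsGlobalLerayHopf (ν j) (fun _ => (fun (x : UnitAddTorus (Fin 3)) => (F * (UnitAddTorus.mFourier (Pi.single (1 : Fin 3) (m : ℤ)) x).im * (UnitAddTorus.mFourier (Pi.single (2 : Fin 3) (n : ℤ)) x).re) • EuclideanSpace.single (0 : Fin 3) (1 : ℝ))) (u₀ j) (u j)) ∧ (∀ j, ∫ x, u₀ j x = V • EuclideanSpace.single (2 : Fin 3) (1 : ℝ)) ∧ (∀ j, ∃ C : ℝ, ∀ t : ℝ, 0 ≤ t → kineticEnergy (u j t) ≤ C) ∧ (∀ j, longTimeAvgSup (fun t => ∫ x, inner ℝ ((F * (UnitAddTorus.mFourier (Pi.single (1 : Fin 3) (m : ℤ)) x).im * (UnitAddTorus.mFourier (Pi.single (2 : Fin 3) (n : ℤ)) x).re) • EuclideanSpace.single (0 : Fin 3) (1 : ℝ)) (u j t x)) ≤ meanDissipation (ν j) (u j)) ∧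
      ∃ η : ℝ, 0 < η ∧ ∀ j, η ≤ Λ.longTimeAvg (fun t => ∫ x, inner ℝ ((F * (UnitAddTorus.mFourier (Pi.single (1 : Fin 3) (m : ℤ)) x).im * (UnitAddTorus.mFourier (Pi.single (2 : Fin 3) (n : ℤ)) x).re) • EuclideanSpace.single (0 : Fin 3) (1 : ℝ)) (u j t x))) :=
  dopplerClock_quadratureStressFloor_iff_energyFreeInjectionFloor

/-! ## (e) Near-miss: the shape of the unconditional kill -/

/-- **Sweeping decorrelation** — the statement whose proof would be `¬ C1` (census format
`StrategyCensus.not_crux_iff`): for EVERY admissible design, generalized limit and pinned no-leak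
vanishing-viscosity Leray–Hopf family of the Doppler force, the quadrature stress has no `ν`-uniform
floor.  By (b) it would follow from "every such family is dormant" (no anomalous dissipation for this
force at pinned momentum `V e₂`), the negation of the zeroth law for one explicit smooth force. -/
def SweepDecorrelation : Prop :=
  ∀ (F V : ℝ) (m n : ℕ), 0 < F ∧ 0 < V ∧ 0 < m ∧ 0 < n → ∀ (Λ : GeneralizedLimit) (ν : ℕ → ℝ) (u₀ : ℕ → UnitAddTorus (Fin 3) → EuclideanSpace ℝ (Fin 3)) (u : ℕ → ℝ → UnitAddTorus (Fin 3) → EuclideanSpace ℝ (Fin 3)),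
    (∀ j, 0 < ν j) → Filter.Tendsto ν Filter.atTop (nhds 0) → (∀ j, IsGlobalLerayHopf (ν j) (fun _ => (fun (x : UnitAddTorus (Fin 3)) => (F * (UnitAddTorus.mFourier (Pi.single (1 : Fin 3) (m : ℤ)) x).im * (UnitAddTorus.mFourier (Pi.single (2 : Fin 3) (n : ℤ)) x).re) • EuclideanSpace.single (0 : Fin 3) (1 : ℝ))) (u₀ j) (u j)) → (∀ j, ∫ x, u₀ j x = V • EuclideanSpace.single (2 : Fin 3) (1 : ℝ)) → (∀ j, ∃ C : ℝ, ∀ t : ℝ, 0 ≤ t → kineticEnergy (u j t) ≤ C) → (∀ j, longTimeAvgSup (fun t => ∫ x, inner ℝ ((F * (UnitAddTorus.mFourier (Pi.single (1 : Fin 3) (m : ℤ)) x).im * (UnitAddTorus.mFourier (Pi.single (2 : Fin 3) (n : ℤ)) x).re) • EuclideanSpace.single (0 : Fin 3) (1 : ℝ)) (u j t x)) ≤ meanDissipation (ν j) (u j)) →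
    ¬ ∃ ε₀ : ℝ, 0 < ε₀ ∧ ∀ j, ε₀ ≤ -Λ.longTimeAvg (fun t => ∫ x, inner ℝ (u j t x - V • EuclideanSpace.single (2 : Fin 3) (1 : ℝ)) (convect (fun y => u j t y - V • EuclideanSpace.single (2 : Fin 3) (1 : ℝ)) (fun (y : UnitAddTorus (Fin 3)) => ((UnitAddTorus.mFourier (Pi.single (1 : Fin 3) (m : ℤ)) y).im * (UnitAddTorus.mFourier (Pi.single (2 : Fin 3) (n : ℤ)) y).im) • EuclideanSpace.single (0 : Fin 3) (1 : ℝ)) x))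

/-- The format is right: sweeping decorrelation refutes the crux (pure logic). -/
theorem not_quadratureStressFloor_of_sweepDecorrelation (h : SweepDecorrelation) : ¬ QuadratureStressFloor := by
  rintro ⟨F, V, m, n, hF, hV, hm, hn, Λ, ν, u₀, u, hν, hν0, hLH, hmom, hsup, hnoleak, hfloor⟩
  exact h F V m n ⟨hF, hV, hm, hn⟩ Λ ν u₀ u hν hν0 hLH hmom hsup hnoleak hfloor

/-- NEAR-MISS (open; `sorry` permitted only in this work file).  Obstruction: a proof needs bounds on
`−Λ⟨T_s(w)⟩` that are `o(1)` as `ν → 0` UNIFORMLY over all pinned no-leak Leray–Hopf solutions —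
i.e. (by (b) and the work identity 18133) that the injection `Λ⟨(f,u)⟩` of every such family tends
to `0`: enhanced-dissipation / sweeping estimates for the drift `V e₂` are available only for the
LINEAR advection–diffusion problem (relaxation enhancement, Constantin–Kiselev–Ryzhik–Zlatoš 2008)
and for the laminar branch (items 18132, 18134), not for nonlinear Leray–Hopf flows far from it;
non-uniqueness and the absence of `ν`-uniform regularity leave no handle.  Tried and landed instead:
the quiet classes it would have to cover one by one (laminar, longitudinal, dormant).  Evidence
AGAINST this statement (i.e. for C1): j023171/j023208/j023236 (ν-uniform instability of the drifted
streaks), j023174 (DNS stress floor alive down to ν = 2.5e-3). -/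
theorem sweepDecorrelation : SweepDecorrelation := by
  sorry

end Summit.AnomalousDissipation.AnomalousDissipation.Cruxes.QuadratureStressFloor.Disproof

end
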